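import Mathlib
import Summits.ResolutionOfSingularities.ResolutionOfSingularities.Theorems.WeightedInvariantLocalWeightedDropNCSmoothPower

/-!
# `LocalWeightedDrop`, line `nc-game-transport`, TOT rung R0 (part B, for R2's terminal positions): a unit times powers of LINEARLY
# INDEPENDENT LINEAR FORMS has normal-crossing support

[OURS · L1 W4.3 · chain w43, engine crux `LocalWeightedDrop` stmt-ResolutionOfSingularities-8899; strategist res-L1-w43-strat-1, line
`nc-game-transport`, rung spec `L/res-L1-w43-strat-1/TOT-RUNGS-SPEC.md` §R0/§R2 (R0 → res-D-pv-006; R2 = hyperplane arrangements, holder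
res-type-088, whose terminal case «μ(A) = 0 ⇔ the forms are linearly independent ⇒ after a linear `Φ` they are coordinates ⇒ NC» this file
settles once and for all).  Objects = the programme's own count game (`TameFourTupleDrop.GermIsNC`, …SpaceCountDefs); NOT a statement of any
manuscript; closes nothing by name.]

* `exists_matrix_rows_of_linearIndependent` — BASIS COMPLETION IN MATRIX FORM: a linearly independent family `a : ι → kⁿ` consists of
  distinct rows `r i` of an invertible `n × n` matrix `M` (`Module.Basis.extend` on `range a`, a `Fintype.equivFinOfCardEq` numbering of the
  completed basis, `Matrix.linearIndependent_rows_iff_isUnit`).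
* `germIsNC_unit_mul_prod_pow_of_linearIndependent` — for `a : ι → kⁿ` linearly independent (`ι` finite), exponents `m : ι → ℕ` and
  `u(0) ≠ 0`:  `GermIsNC (u · ∏ᵢ (∑ⱼ a i j · xⱼ)^{m i})` — the product is `∏ₗ (linSubst M l)^{v l}` for the completed matrix (`v` = `m`
  extended by `0`, `Function.extend`), and `germIsNC_unit_mul_prod_pow_linForms` (part A) applies.
* `germIsNC_unit_mul_prod_pow_of_linearIndepOn` — the `Finset` spelling: `A : Finset kⁿ` with `LinearIndepOn k id ↑A`, multiplicities
  `m : kⁿ → ℕ`:  `GermIsNC (u · ∏_{a ∈ A} (∑ⱼ a j · xⱼ)^{m a})`.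
-/

noncomputable section

open Literature.AlgebraicGeometry.Resolution

set_option linter.dupNamespace false -- mandated namespace of this single-conjunct summit

namespace Summit.ResolutionOfSingularities.ResolutionOfSingularities.Theorems

namespace NCTransport

open MvPowerSeries TameFourTupleDrop

variable {k : Type} [Field k]

/-- BASIS COMPLETION IN MATRIX FORM: a linearly independent family `a : ι → kⁿ` consists of distinct rows of some invertible `n × n` matrix —
there are `M` with `IsUnit M.det` and an injective `r : ι → Fin n` with `M (r i) = a i`. -/
theorem exists_matrix_rows_of_linearIndependent {n : ℕ} {ι : Type} {a : ι → (Fin n → k)} (ha : LinearIndependent k a) :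
    ∃ (M : Matrix (Fin n) (Fin n) k) (r : ι → Fin n), IsUnit M.det ∧ Function.Injective r ∧ ∀ i, M (r i) = a i := by
  classical
  set s : Set (Fin n → k) := Set.range a with hs_def
  have hs : LinearIndepOn k id s := ha.linearIndepOn_id
  set B := Module.Basis.extend hs with hB_def
  have hsub : s ⊆ hs.extend (Set.subset_univ s) := hs.subset_extend _
  haveI : Fintype (hs.extend (Set.subset_univ s)) := FiniteDimensional.fintypeBasisIndex B
  have hcard : Fintype.card (hs.extend (Set.subset_univ s)) = n := by
    rw [← Module.finrank_eq_card_basis B, Module.finrank_fin_fun]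
  set σ := Fintype.equivFinOfCardEq hcard with hσ_def
  refine ⟨fun r => ((σ.symm r : hs.extend (Set.subset_univ s)) : Fin n → k), fun i => σ ⟨a i, hsub ⟨i, rfl⟩⟩, ?_, ?_, ?_⟩
  · rw [← Matrix.isUnit_iff_isUnit_det]
    refine Matrix.linearIndependent_rows_iff_isUnit.mp ?_
    have hB : LinearIndependent k (fun x : hs.extend (Set.subset_univ s) => (x : Fin n → k)) := by
      have := B.linearIndependent
      rwa [hB_def, Module.Basis.coe_extend] at this
    exact hB.comp σ.symm σ.symm.injective
  · intro i j hij
    have h := Subtype.ext_iff.mp (σ.injective hij)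
    exact ha.injective h
  · intro i
    simp

/-- **A UNIT TIMES POWERS OF LINEARLY INDEPENDENT LINEAR FORMS IS NC** (OURS · L1 W4.3, rung R0 part B; the terminal positions of rung R2):
for a linearly independent family of coefficient vectors `a : ι → kⁿ` (`ι` finite), any exponents `m`, and `u(0) ≠ 0`,
`GermIsNC (u · ∏ᵢ (∑ⱼ a i j · xⱼ)^{m i})`. -/
theorem germIsNC_unit_mul_prod_pow_of_linearIndependent {n : ℕ} {ι : Type} [Fintype ι] {a : ι → (Fin n → k)}
    (ha : LinearIndependent k a) {u : MvPowerSeries (Fin n) k} (hu : constantCoeff u ≠ 0) (m : ι → ℕ) :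
    GermIsNC (u * ∏ i, (∑ j, a i j • X j) ^ m i) := by
  classical
  obtain ⟨M, r, hM, hr, hMr⟩ := exists_matrix_rows_of_linearIndependent ha
  have key : ∏ i, (∑ j, a i j • (X j : MvPowerSeries (Fin n) k)) ^ m i =
      ∏ l, FormalCoordChange.linSubst M l ^ Function.extend r m 0 l := by
    rw [← Finset.prod_subset (Finset.subset_univ (Finset.univ.image r)), Finset.prod_image fun i _ j _ h => hr h]
    · refine Finset.prod_congr rfl fun i _ => ?_
      rw [hr.extend_apply, FormalCoordChange.linSubst, hMr]
    · intro l _ hl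
      rw [Function.extend_apply' _ _ _ (fun ⟨i, hi⟩ => hl (Finset.mem_image.mpr ⟨i, Finset.mem_univ _, hi⟩)), Pi.zero_apply, pow_zero]
  rw [key]
  exact germIsNC_unit_mul_prod_pow_linForms hM hu _

/-- The `Finset` spelling: for a finite set `A ⊆ kⁿ` of linearly independent coefficient vectors, multiplicities `m : kⁿ → ℕ` and `u(0) ≠ 0`,
`GermIsNC (u · ∏_{a ∈ A} (∑ⱼ a j · xⱼ)^{m a})`. -/
theorem germIsNC_unit_mul_prod_pow_of_linearIndepOn {n : ℕ} {A : Finset (Fin n → k)} (hA : LinearIndepOn k id (A : Set (Fin n → k)))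
    {u : MvPowerSeries (Fin n) k} (hu : constantCoeff u ≠ 0) (m : (Fin n → k) → ℕ) :
    GermIsNC (u * ∏ a ∈ A, (∑ j, a j • X j) ^ m a) := by
  have h := germIsNC_unit_mul_prod_pow_of_linearIndependent (ι := (A : Set (Fin n → k))) hA.linearIndependent hu (fun a => m a)
  rwa [← Finset.prod_coe_sort A]

end NCTransport

end Summit.ResolutionOfSingularities.ResolutionOfSingularities.Theorems
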